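import Literature.AnabelianGeometry.EtaleTheta.TemperedFrobenioidOfKummerTateTower
import Literature.AnabelianGeometry.EtaleTheta.TemperedFrobenioidOfGaloisCoveringRankOnePointR
import HarnessLib

/-!
# [EtTh] Def. 3.6 (ii) at monoid type `Λ = ℝ` over ANY Def. 3.3 (iii) datum at a RANK-ONE OBJECT (`dm`-generic engine), and its
# instance at the v2 MODEL OF RECORD (Kummer–Tate tower)

S. Mochizuki, *The étale theta function and its Frobenioid-theoretic manifestations*, Publ. RIMS **45** (2009), Def. 3.6 (i)(ii)
pp.76–77 (`Λ = ℝ`: `B₀^ℝ := ℝ·Φ₀^birat`, `F₀^ℝ := ℝ·Φ₀^cnst`; "`Φ` := the image of `Φ₀^pf`") [cite: MochizukiEtTh2009, Def 3.6 p.77];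
S. Mochizuki, *The geometry of Frobenioids II* (2008), Ex. 1.1 [cite: MochizukiFrdII2008, Ex. 1.1 p.408].

abc-iut cell, layer L2, seat abc-iut-L2-d2 (gen 5); item (e) of the v2 chain (memo `VNEXT-V2-RealifiedChain-L2d2.md` §2: "only the
`Λ = ℝ` engine `ofRankOnePointR` lacks a `dm`-generic twin").  CLASS (b) MODEL / NON-VACUITY construction (defs + theorems;
0 instances / notation / `Prop` facts; flagged to ref-d).  CREDIT: the construction is VERBATIM abc-iut-w6-d048's
`TemperedFrobenioid.ofRankOnePointR` (`TemperedFrobenioidOfGaloisCoveringRankOnePointR.lean`, p447026) with the particular datum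
`DivisorMonoids.ofGaloisActionConnected A hZ` / `RankOnePoint` replaced by an ARBITRARY datum `dm : DivisorMonoids D₀` / abc-iut-w5-d179's
`dm.RankOneObject` (exactly as their `ofRankOneObject` generalises `ofRankOnePoint` at `Λ = ℤ`); nothing landed is edited.

* `DivisorMonoids.RankOneObject.gpMap_toR_mem_realSpan_biratGp`, `cnstFnR (m : Φ₀(Y₀)) ∈ B₀^ℝ(Y₀) = ℝ·Φ₀^birat(Y₀)` (the image of
  `div₀ b`, `b` the constant with `div₀ b = m` from `hcnst`), `cnstFnR_mem_FΛ`, `divΛ_cnstFnR`;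
* **`TemperedFrobenioid.ofRankOneObjectR P hpf R S : TemperedFrobenioid (ofRlfRWeak dm hpf) (Discrete PUnit) (treeCatVocab …)`** — every
  condition PROVED; `ofRankOneObjectR_monoidType`, `_Φ_carrier`, `_base`, `nonempty_of_rankOneObjectR`, and «`C` is a Frobenioid»
  `isFrobenioid_ofRankOneObjectR` (model Frobenioid over the one-point base, [FrdI] Thm. 5.2 (ii));
* INSTANCE **`TateTowerKummer.temperedFrobenioidR R S`** — the tempered Frobenioid of monoid type `ℝ` over the v2 MODEL OF RECORD
  (`ofRlfRWeak (DivisorMonoids.ofTower TateTowerKummer.tower) hpf`, rank-one object `TateTowerKummer.rankOneObject`, p465559);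
  `isFrobenioid_temperedFrobenioidR`, `nonempty_temperedFrobenioidR_ofTower`.

HONEST LABEL: genuine weak vocabularies and CONSTRUCTED data; `D` one object — an instantiation witness, not the tempered Frobenioid of a
Tate curve.  Nothing here bears on [IUTchIII] Cor. 3.12; no side taken; typed ≠ proved for anything else.
-/

noncomputable section

namespace Literature.AnabelianGeometry.EtaleTheta

open CategoryTheory Opposite Function Literature.AlgebraicGeometry.Frobenioids Literature.AnabelianGeometry.SemiGraphs
  LogDivisorModel LogDivisorModel.GaloisAction

universe u₀ v₀

namespace DivisorMonoids

namespace RankOneObject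

variable {D₀ : Type u₀} [Category.{v₀} D₀] {dm : DivisorMonoids.{u₀, v₀, 0} D₀} (P : dm.RankOneObject)
  (hpf : ∀ Y : D₀ᵒᵖ, IsPerfFactorialCof (dm.Φ₀.obj Y))

/-- The image `ι(c) ∈ (Φ₀^ℝ)^gp(Y₀)` of a log-divisor class `c = div₀ b ∈ Φ₀^birat(Y₀)` lies in `B₀^ℝ(Y₀) = ℝ·Φ₀^birat(Y₀)`.
[cite: MochizukiEtTh2009, Def 3.6 p.76] -/
theorem gpMap_toR_mem_realSpan_biratGp {c : Algebra.GrothendieckGroup (dm.Φ₀.obj (op P.Y₀))} (b : dm.B₀.obj (op P.Y₀))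
    (hbc : dm.div₀ (op P.Y₀) b = c) :
    EtaleTheta.gpMap ((RealifiedDivisorMonoids.ofRlfRWeak dm hpf).toR (op P.Y₀)) c ∈
      ((RealifiedDivisorMonoids.realDataWeak dm hpf).realSpan dm.biratGp).carrier P.Y₀ := by
  have h := (RealifiedDivisorMonoids.realDataWeak dm hpf).toRlfGp_mem_realSpan dm.biratGp P.Y₀ (c := c)
    (Subgroup.subset_closure ⟨b, hbc⟩)
  rw [RealifiedDivisorMonoids.toRlfGp_realDataWeak_eq] at h
  exact h

/-- The constant `ι(div₀ b) ∈ B₀^ℝ(Y₀)` attached to `m ∈ Φ₀(Y₀)` (`b` constant with `div₀ b = m`, from `hcnst`).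
[cite: MochizukiEtTh2009, Def 3.6 p.76] -/
def cnstFnR (m : dm.Φ₀.obj (op P.Y₀)) : (RealifiedDivisorMonoids.ofRlfRWeak dm hpf).BΛ.obj (op P.Y₀) :=
  ⟨EtaleTheta.gpMap ((RealifiedDivisorMonoids.ofRlfRWeak dm hpf).toR (op P.Y₀)) (Algebra.GrothendieckGroup.of m),
    P.gpMap_toR_mem_realSpan_biratGp hpf (P.hcnst m).choose (P.hcnst m).choose_spec.2⟩

/-- `ι(div₀ b) ∈ F₀^ℝ(Y₀) = B₀^ℝ(Y₀) ∩ ℝ·Φ₀^cnst(Y₀)` (the function `b` is constant). [cite: MochizukiEtTh2009, Def 3.6 p.76] -/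
theorem cnstFnR_mem_FΛ (m : dm.Φ₀.obj (op P.Y₀)) : P.cnstFnR hpf m ∈ (RealifiedDivisorMonoids.ofRlfRWeak dm hpf).FΛ (op P.Y₀) := by
  obtain ⟨hb, hbm⟩ := (P.hcnst m).choose_spec
  have key := (RealifiedDivisorMonoids.ofRlfRWeak dm hpf).cnst_le_cnstR (op P.Y₀) (P.hcnst m).choose hb
  change EtaleTheta.gpMap ((RealifiedDivisorMonoids.ofRlfRWeak dm hpf).toR (op P.Y₀)) (dm.div₀ (op P.Y₀) (P.hcnst m).choose) ∈
    (RealifiedDivisorMonoids.ofRlfRWeak dm hpf).cnstR (op P.Y₀) at key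
  rw [show dm.div₀ (op P.Y₀) (P.hcnst m).choose = Algebra.GrothendieckGroup.of m from hbm] at key
  exact key

/-- Its log-divisor `Div(ι(div₀ b)) ∈ (Φ₀^ℝ)^gp(Y₀)` is `ι(m)` (`B₀^ℝ → (Φ₀^ℝ)^gp` is the inclusion). [cite: MochizukiEtTh2009, Def 3.6 p.76] -/
theorem divΛ_cnstFnR (m : dm.Φ₀.obj (op P.Y₀)) :
    (RealifiedDivisorMonoids.ofRlfRWeak dm hpf).divΛ (op P.Y₀) (P.cnstFnR hpf m) =
      EtaleTheta.gpMap ((RealifiedDivisorMonoids.ofRlfRWeak dm hpf).toR (op P.Y₀)) (Algebra.GrothendieckGroup.of m) := rfl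

end RankOneObject

end DivisorMonoids

/-! ### The `Λ = ℝ` tempered Frobenioid at a rank-one object -/

namespace TemperedFrobenioid

variable {D₀ : Type u₀} [Category.{v₀} D₀] {dm : DivisorMonoids.{u₀, v₀, 0} D₀} (P : dm.RankOneObject)
  (hpf : ∀ Y : D₀ᵒᵖ, IsPerfFactorialCof (dm.Φ₀.obj Y)) (R S : ((Discrete PUnit.{1})ᵒᵖ ⥤ CommMonCat.{0}) → Prop)

/-- **Def. 3.6 (ii) data of MONOID TYPE `ℝ` over ANY Def. 3.3 (iii) datum at a rank-one object** (`B₀^ℝ = ℝ·Φ₀^birat`; base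
`pt ↦ Y₀`; `Φ := im(Φ₀(Y₀)^pf → Φ₀(Y₀)^rlf)` as at `Λ = ℤ`); every condition PROVED — abc-iut-w6-d048's `ofRankOnePointR`, `dm`-generic.
[cite: MochizukiEtTh2009, Def 3.6 p.77] -/
def ofRankOneObjectR :
    TemperedFrobenioid (RealifiedDivisorMonoids.ofRlfRWeak dm hpf) (Discrete PUnit.{1}) (treeCatVocab (Discrete PUnit.{1}) R S) where
  isConnected := Toy.temperedFrobenioid.isConnected
  isTotallyEpimorphic := Toy.temperedFrobenioid.isTotallyEpimorphic
  base := P.base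
  Φ := P.Φsub hpf
  isGroupSaturated _ := PfImageWeak.isGroupSaturated_mrange_toRealification (hpf (op P.Y₀)).weak
  isPerfFactorial _ := PfImageWeak.isPerfFactorialCof_mrange_toRealification (hpf (op P.Y₀))
  isDivisorialOn := by
    rw [treeCatVocab_isDivisorialOn]
    exact ⟨Cor38Toy.isMonoidOn_of_punit _, fun _ => PfImageWeak.isDivisorial_mrange_toRealification (hpf (op P.Y₀))⟩
  isMonoprime_bsFld _ :=
    IsMonoprime.of_mulEquiv (MulEquiv.submonoidCongr (P.pfImage_inf_cnstR_eq hpf).symm) (P.isMonoprime_pfImage hpf)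
  exists_FΛ_div_ne _ :=
    ⟨P.cnstFnR hpf (P.e.symm (Multiplicative.ofAdd 1)), P.cnstFnR_mem_FΛ hpf _,
      (hpf (op P.Y₀)).weak.toRealification (Perfection.of _ (P.e.symm (Multiplicative.ofAdd 1))), ⟨_, rfl⟩,
      1, one_mem _, P.toRealification_gen_ne_one hpf, by
        simp only [map_one, div_one]
        change (RealifiedDivisorMonoids.ofRlfRWeak dm hpf).divΛ (op P.Y₀) (P.cnstFnR hpf (P.e.symm (Multiplicative.ofAdd 1))) = _
        rw [DivisorMonoids.RankOneObject.divΛ_cnstFnR]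
        exact EtaleTheta.gpMap_of _ _⟩

/-- The monoid type of the witness is `ℝ`. [cite: MochizukiEtTh2009, Def 3.6 p.77] -/
theorem ofRankOneObjectR_monoidType : (ofRankOneObjectR P hpf R S).monoidType = MonoidType.R := rfl

/-- `Φ` of the witness is `im(Φ₀^pf → Φ₀^rlf)`. [cite: MochizukiEtTh2009, Def 3.6 p.77] -/
theorem ofRankOneObjectR_Φ_carrier (X : (Discrete PUnit.{1})ᵒᵖ) : (ofRankOneObjectR P hpf R S).Φ.carrier X = P.pfImage hpf := rfl

/-- The base functor of the witness is constant at `Y₀`. [cite: MochizukiEtTh2009, Def 3.6 p.77] -/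
theorem ofRankOneObjectR_base : (ofRankOneObjectR P hpf R S).base = P.base := rfl

/-- **NON-VACUITY of the `Λ = ℝ` theorem family over `ofRlfRWeak dm hpf`** at every datum with a rank-one object.
[cite: MochizukiEtTh2009, Def 3.6 p.77] -/
theorem nonempty_of_rankOneObjectR (P₀ : dm.RankOneObject) (R₀ S₀ : ((Discrete PUnit.{1})ᵒᵖ ⥤ CommMonCat.{0}) → Prop) :
    Nonempty (TemperedFrobenioid (RealifiedDivisorMonoids.ofRlfRWeak dm hpf) (Discrete PUnit.{1})
      (treeCatVocab (Discrete PUnit.{1}) R₀ S₀)) :=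
  ⟨ofRankOneObjectR P₀ hpf R₀ S₀⟩

/-- **The `Λ = ℝ` witness IS a Frobenioid** ([FrdI] Thm. 5.2 (ii): the model Frobenioid over the one-point base; no `hBinj` needed).
[cite: MochizukiFrdI2008, Thm. 5.2 (ii) p.100] -/
theorem isFrobenioid_ofRankOneObjectR : PreFrobenioid.IsFrobenioid (ofRankOneObjectR P hpf R S).toElem :=
  ModelFrobenioid.isFrobenioid (Cor38Toy.isMonoidOn_of_punit _)
    (fun _ => PfImageWeak.isDivisorial_mrange_toRealification (hpf (op P.Y₀))) (Cor38Toy.isMonoidOn_of_punit _)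
    ((ofRankOneObjectR P hpf R S).isGroupLike_ratFnFunctor (RealifiedDivisorMonoids.ofRlfRWeak dm hpf).isUnit_BΛ)
    (isGraphConnected_iff_isConnected.mpr (ofRankOneObjectR P hpf R S).isConnected)
    (ofRankOneObjectR P hpf R S).isTotallyEpimorphic

end TemperedFrobenioid

/-! ### Instance: the v2 MODEL OF RECORD -/

namespace TateTowerKummer

open LogDivisorTower

variable (R S : ((Discrete PUnit.{1})ᵒᵖ ⥤ CommMonCat.{0}) → Prop)

/-- **The tempered Frobenioid of MONOID TYPE `ℝ` over the v2 MODEL OF RECORD** (the Kummer–Tate tower's Def. 3.3 (iii) data with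
covering-indexed `Mero`, at its rank-one object `pt = Grp/Grp`). [cite: MochizukiEtTh2009, Def 3.6 p.77] -/
def temperedFrobenioidR :
    TemperedFrobenioid (RealifiedDivisorMonoids.ofRlfRWeak (DivisorMonoids.ofTower tower) hpf) (Discrete PUnit.{1})
      (treeCatVocab (Discrete PUnit.{1}) R S) :=
  TemperedFrobenioid.ofRankOneObjectR rankOneObject hpf R S

/-- Its monoid type is `ℝ`. [cite: MochizukiEtTh2009, Def 3.6 p.77] -/
theorem temperedFrobenioidR_monoidType : (temperedFrobenioidR R S).monoidType = MonoidType.R := rfl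

/-- **NON-VACUITY, `Λ = ℝ`, at the v2 model of record.** [cite: MochizukiEtTh2009, Def 3.6 p.77] -/
theorem nonempty_temperedFrobenioidR_ofTower :
    Nonempty (TemperedFrobenioid (RealifiedDivisorMonoids.ofRlfRWeak (DivisorMonoids.ofTower tower) hpf) (Discrete PUnit.{1})
      (treeCatVocab (Discrete PUnit.{1}) R S)) :=
  ⟨temperedFrobenioidR R S⟩

/-- **«`C` is a Frobenioid», `Λ = ℝ`, at the v2 model of record.** [cite: MochizukiFrdI2008, Thm. 5.2 (ii) p.100] -/
theorem isFrobenioid_temperedFrobenioidR : PreFrobenioid.IsFrobenioid (temperedFrobenioidR R S).toElem :=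
  TemperedFrobenioid.isFrobenioid_ofRankOneObjectR rankOneObject hpf R S

end TateTowerKummer

end Literature.AnabelianGeometry.EtaleTheta

end
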